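import Literature.MathematicalPhysics.QuantumFieldTheory.Balaban1983to89.B8Thm2T3FamilyBinderSharp

/-!
# `Balaban1983to89.B8Thm2TorusB9LineReduced` — M5.9 ASSEMBLY, FILE A16: the (B)-line `B9P3PerAt` of [Balaban1985RegularSpaces] (1.59) on `T_η`
# REDUCED TO ITS THREE GENUINE MEMBERS («|A|₍₋₁₎, |∇^η_{U₀}A|₍₋₂₎, |Δ^η_{U₀}A|₍₋₃₎ ≦ B₀(|J|₍₋₃₎ + |B₁|)», pointwise at the top weight), the
# `|D^{η*}_{U₀}D^η_{U₀}A|₍₋₃₎` member being `|J|₍₋₃₎` itself and the Hölder member being read at `β = 0` (the binder's `β₀ = 0`); the route-K socket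
# `SockB9P3` at `({T_η}, torusLam, torusLamb)` as an alternative feed; and the consumer binder `hThm2_of_core_three` with the (B)-lines so reduced

statement-level skeleton of published theorems with citation tags; proofs where landed; nothing here is a claim about the
Yang–Mills mass gap

T. Bałaban, *Spaces of regular gauge field configurations on a lattice and gauge fixing conditions*, Commun. Math. Phys. **99** (1985) 75–102
[`Balaban1985RegularSpaces`, "[B8]"]: p. 86 (*«Theorem 3.3 of [4] implies the bounds: |A|₍₋₁₎, |∇^η_{U₀}A|₍₋₂₎, |D^{η\*}_{U₀}D^η_{U₀}A|₍₋₃₎, |Δ^η_{U₀}A|₍₋₃₎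
≦ B₀(|J|₍₋₃₎ + |B₁|) (1.59)»*; *«|A|₍α₎ = sup_j sup_{Ω_j}(Lʲη)^{−α}|A|»*; (1.55)–(1.58)), Prop. 3 p. 87 (*«B₂(β₀) = 5dLB₀(β₀)»*), p. 77 (*«we admit the
case where some domains Ω_j are equal to T_η»*), Thm 2 p. 83.  T. Bałaban, *Propagators for lattice gauge theories in a background field*, Commun. Math.
Phys. **99** (1985) 389–434 [`Balaban1985BackgroundPropagators`, "[4]"]: Thm 3.3 p. 399, (3.47) p. 398 (the global weighted inequalities
`|G′λ|₍₂₊ᵧ₎, |∇_U G′λ|₍₁₊ᵧ₎, |Δ_U G′λ|₍ᵧ₎ ≦ B₀|λ|₍ᵧ₎`, `γ ∈ [−4, 4]`), (3.40) p. 397 (the Hölder quotients).  PDFs held: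
`paper:balaban1985-cmp99-regular-spaces-gauge-fixing` (p. 86 = `p0012.txt` re-read this generation), `paper:balaban1985-cmp99-background-propagators`
(pp. 397–399 = `p0009.txt`–`p0011.txt`).  STATUS: published, refereed.

CITATION HEADER (lean-in-tree rule).  Cell `lit-balaban`, seat `lit-balaban-t2s-1` (gen 6), MODULE M5.9, file A16; sub-row G-B8-T2S «[B8] §3 Thm 2 TORUS
SUPPLIER» (R3 `stmt-QuantumFields-19200`, helper).  REUSED BY NAME: file A4 `B8Thm2TorusKnitEstimatesOfMajorants.B9P3PerAt` (the (B)-line, verbatim the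
`b9P3` law of `LettersAtPer` ∕ `KnitEstimates`), file A15 `B8Thm2T3FamilyBinderSharp.hThm2_of_core_sharp`, `B8LeafModelZd3.SockB9P3` (route K ∕ the
`pub-ymgap` N05 knit's b9 socket), `B8ScaledSupNorm.{msup, bondNorm, weight, msup_le, msup_nonneg, weight_neg_natCast, scale_pos}`, `B8Eq155JBound.{Jcur,
wsup, wsup_nonneg}`, `B9Eq340HolderZd.{hquot, AdmPair, norm_trans}`, `B8Thm2TorusSupplier.sideTouches_univ`, `B7Prop2SpecialUnitary.specialUnitaryUnits_le_unitaryUnits`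
— the `β = 0` device is `B8Thm2TorusSock142159.sock159_of_sockB9P3`'s (line 5 from line 2 at both points, transport isometric), here one level up,
inside the (B)-line itself.

WHY THIS FILE ∕ THE ARGUMENT.  After files A8–A15 the sub-row's displayed surface is {`KnitCubeCore` per member ([4] Thm 3.7∕3.9 cube data, owners p21∕p33∕p38),
the (B)-lines `B9P3PerAt` per member, the volume floor}.  The (B)-line is print's (1.59) in the frame of truncation `m` on `T_η` — FIVE weighted-supremum
lines (sup, covariant gradient, `D^{η*}D^η`, covariant Laplacian, Hölder quotients of the gradient at exponent `β`) bounded by `B₀(|J|₍₋₃₎ + |B₁|)`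
(`J = D^{η*}_{U₀}D^η_{U₀}A′` — `B8Eq155JBound.Jcur`, `|B₁|` the weighted sup of the linear averages `LʲηQ_j(U₀)A′` on `𝔅_m`).  Two of the five are NOT
estimates: (i) the `D^{η*}D^η` member IS `|J|₍₋₃₎` (`Jcur η U₀ A′ μ x = pdiv η U₀ (plaqCovDeriv η U₀ A′) μ x`, `rfl`), so it holds for every `B₀ ≥ 1`;
(ii) the binder of record (`hThm2_of_core`, A14∕A15) concludes `Thm2SetupSUAt … β₀ …` with `β₀ := 0`, and the Hölder exponent `βH` of the (B)-line is a FREE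
parameter of that binder — at `β = 0` the (3.40) quotient `‖R(U₀(Γ_{x,x′}))(D A′)(x′) − (D A′)(x)‖ ∕ (η|x′−x|)⁰` is at most `‖DA′(x′)‖ + ‖DA′(x)‖` (the
transport `R(U₀(Γ))` is isometric for unitary `U₀`, `norm_trans`), so the Hölder line holds with constant `2B₀` from the gradient line.  Moreover on `T_η`
every `Ω_j = T_η`, so every bond «belongs to Ω_j» for every `j ≤ m` and the multi-level weight `(Lʲη)ᵖ` is largest at `j = m`: each weighted line is its
POINTWISE reading at the top weight `(Lᵐη)ᵖ`.  Hence the honest content of the (B)-line a [4]-side supplier must prove is EXACTLY THREE pointwise lines —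
[4] (3.47) at `γ = −3` for the map `A′ ↦ (J, B₁)` on Landau periodic fields: `(Lᵐη)‖A′(b)‖`, `(Lᵐη)²‖(D^η_{U₀,μ}A′_κ)(y)‖`, `(Lᵐη)³‖(Δ^η_{U₀}A′_κ)(y)‖ ≦
B₀(|J|₍₋₃₎ + |B₁|)` — the predicate ★ `B9P3ThreeAt` of §1 (same data and hypotheses as `B9P3PerAt`, the two vacuous side-clauses of the all-torus
sequence dropped: `SideTouches T_η y τ` always holds for `d + 1 ≥ 2`, `sideTouches_univ`).

WHAT THIS FILE PROVES (sorry-free; one definition with a body — the predicate `B9P3ThreeAt` —, everything else theorems; no estimate of [B8]∕[4] asserted).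
* §1 ★ **`B9P3ThreeAt L B₀ c_B η m α₀ P U₀`** — the three pointwise lines at the top weight, for periodic unitary Landau `W = e^{iηA′}` over `U₀` with
  `U₀, WU₀ ∈ 𝔄_m({T_η}, α₀)`, `A′` Hermitian periodic, `‖A′‖ ≤ α₂(Lᵐη)⁻¹`, `α₂ ≤ c_B`.
* §2 ★★ **`b9P3PerAt_of_three`** — for `d + 1 ≥ 2`, `L ≥ 1`, `η > 0`, `B₀ ≥ 1`, unitary `U₀`: `B9P3ThreeAt L B₀ c_B η m α₀ P U₀ → B9P3PerAt L B₀ (2B₀) c_B 0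
  len η m α₀ P U₀` for EVERY length function `len` (lines 1∕2∕4 by monotonicity of the weight in `j`; line 3 = `|J|₍₋₃₎ ≤ B₀(|J|₍₋₃₎ + |B₁|)`; line 5 at
  `β = 0` from line 2 at both points).
* §3 ★ **`b9P3PerAt_of_sockB9P3`** — the route-K ∕ N05 socket `SockB9P3 L B₀ B₀β c_B β len η m {T_η} torusLam torusLamb` (quantified over ALL unitary
  `U₀, W` and all Hermitian `A′`) gives the (B)-line at every unitary `U₀` with `0 < α₀ ≤ c_B` (the periodicity clauses are simply not used) — so any
  supplier of that socket at the all-torus member (e.g. the `pub-ymgap` lineage `B9SupplySockB9P3ZdAt.sockB9P3_at_univ'` modulo ITS displayed [4]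
  Thm-3.3 binders) feeds the sub-row BY NAME.
* §4 ★★★★★★★ **`hThm2_of_core_three`** — file A15's `hThm2_of_core_sharp` with the (B)-line hypothesis REPLACED by `B9P3ThreeAt … B₀ c_B9 (eta F n K) m′ α₀ P₀ U₀`
  (`1 ≤ B₀`; the binder's `β_H := 0`, `B₀β := 2B₀`, `len := 1`): the consumer's `hThm2S` shape modulo {`4 ≤ ℓ`, `k₀ ≤ F.m + n`, `KnitCubeCore` per
  member, THREE (3.47)-lines per member}.

HONEST SCOPE.  Bookkeeping inside print's (1.59): which of its five members carry content at `Ω_j = T_η`, `β₀ = 0`.  NO estimate of [B8]∕[4] is proved: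
the three lines ([4] Thm 3.3 ∕ (3.47) at `γ = −3` for `G(U₀) = Δ_a(U₀)⁻¹`, (3.26)–(3.27) p. 395, composed with (1.57)–(1.58)) stay a DISPLAYED antecedent,
inhabited by nothing here (owners: sub-row G-B9-LETTERS M5.7, p38 lineage, at def-Y's `GAY`; or the `pub-ymgap` N06 binders via §3); the Hölder norms
`B₂(β₀)`, `β₀ > 0` of Prop. 3 are NOT served by this reduction (the binder of record asks `β₀ = 0` only); `L ≥ 5` odd, `N = 2`, `d + 1 = 3` in §4;
count-neutral; N05 ∕ `stub_PV3A` NOT discharged; nothing continuum ∕ ℝ⁴ ∕ OS ∕ mass-gap ∕ Clay — the Yang–Mills mass gap is NOT proved.  No `sorry`, no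
`axiom`, no `… : Prop` fact (§1 is a predicate with a body, the reduced form of A4's `B9P3PerAt`), no `instance`, no `notation`.  NEW file; nothing landed
is modified.  Seat `lit-balaban-t2s-1` gen 6, 2026-08-28.
-/

noncomputable section

open scoped BigOperators

namespace Literature.MathematicalPhysics.QuantumFieldTheory.Balaban1983to89.B8Thm2TorusB9LineReduced

open Node00 B6KLevelCensusIndexV1 B9BackgroundsKLevelV1 B9Thm311ReadingCoords
open B7Prop1Explicit renaming Site → LSite
open B7Prop1Explicit (e U1)
open B7Prop2Explicit (unitaryUnits unitaryUnits_le_U1)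
open B8Ineq132 (covDerivFwd InAk)
open B8Lemma1NonAbelian (mulCfg)
open B8Eq184Proof (cfgExp)
open B8Eq140Level (SideTouches)
open B8Eq138LandauZd (IsLandau138W covLap)
open B8Eq146AExpansion (iEta plaqCovDeriv)
open B8Eq143PlaqExpansion (pdiv)
open B7Prop4GeneralLevels (linCovIter)
open B8Eq155JBound (Jcur wsup wsup_nonneg)
open B8ScaledSupNorm (msup bondNorm weight msup_le msup_nonneg weight_neg_natCast scale_pos)
open B9Eq340HolderZd (hquot AdmPair norm_trans)
open B8Thm4TorusAt (torusLam)
open B8Thm2TorusMember (torusLamb)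
open B8Thm2TorusSupplier (sideTouches_univ)
open B8LeafModelZd3 (SockB9P3)
open B8Thm2TorusKnitEstimatesOfMajorants (B9P3PerAt)
open B9GeoNormsKLevelV1 (geo9K)
open B6GlobalChartV1 (PV)
open B6Ineq2142KLevelV1 (β)
open B8Thm2TorusLettersPerOfKnit (bgY)
open B8Thm2TorusKnitMajorantsOfCubes (KnitCubeParams)
open B8Thm2TorusKnitCubeCore (KnitCubeCore)
open B8Thm2T3FamilyBinderSharp (hThm2_of_core_sharp)
open B7Prop2SpecialUnitary (specialUnitaryUnits specialUnitaryUnits_le_unitaryUnits)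
open B8Thm2SetupTorus (Thm2SetupSUAt)
open T3ContinuumYM3Torus (T3Family)
open T3SectALandauChart (eta eta_pos)
open scoped Matrix Matrix.Norms.L2Operator

/-! ## §1 ★ The three genuine members of the (B)-line, pointwise at the top weight -/

section Three

variable {d : ℕ} {𝔸 : Type} [CStarAlgebra 𝔸]

/-- ★ **THE (B)-LINE REDUCED TO ITS THREE GENUINE MEMBERS** — [B8] (1.59) on `T_η` in the frame of truncation `m` («|A|₍₋₁₎, |∇^η_{U₀}A|₍₋₂₎, |Δ^η_{U₀}A|₍₋₃₎
≦ B₀(|J|₍₋₃₎ + |B₁|)»), read POINTWISE at the top weight `(Lᵐη)ᵖ` (every `Ω_j = T_η`, so the weight `(Lʲη)ᵖ`, `j ≤ m`, binds at `j = m`): for every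
`α₂ ≤ c_B`, every `P`-periodic unitary `W` with `U₀, WU₀ ∈ 𝔄_m({T_η}, α₀)` in the Landau gauge (1.38) of record over `U₀` (`m` levels, `𝔅_m` from
`torusLam m`), and every `P`-periodic Hermitian `A′` with `W = e^{iηA′}` and `‖A′‖ ≤ α₂(Lᵐη)⁻¹`:
`(Lᵐη)‖A′(b)‖`, `(Lᵐη)²‖(D^η_{U₀,μ}A′_κ)(y)‖`, `(Lᵐη)³‖(Δ^η_{U₀}A′_κ)(y)‖ ≦ B₀(|J|₍₋₃₎ + |B₁|)`, `J = D^{η*}_{U₀}D^η_{U₀}A′`, `|B₁|` the weighted sup of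
`LʲηQ_j(U₀)A′` on `𝔅_m` — the right side VERBATIM that of `B9P3PerAt`.  [4] (3.47) at `γ = −3` for `G(U₀)` composed with (1.57)–(1.58); a displayed
hypothesis SHAPE, asserted for nothing here.
[cite: Balaban1985RegularSpaces, (1.59) p.86, (1.57)–(1.58) p.86, p.86 (norms after (1.55)), p.77; Balaban1985BackgroundPropagators, Thm 3.3 p.399, (3.47) p.398] -/
def B9P3ThreeAt (L : ℕ) (B₀ cB : ℝ) (η : ℝ) (m : ℕ) (α₀ : ℝ) (P : ℤ) (U₀ : LSite (d + 1) → Fin (d + 1) → 𝔸ˣ) : Prop :=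
  ∀ α₂ : ℝ, 0 < α₂ → α₂ ≤ cB →
    ∀ W : LSite (d + 1) → Fin (d + 1) → 𝔸ˣ, (∀ x κ, W x κ ∈ unitaryUnits 𝔸) →
    (∀ (z : LSite (d + 1)) (i : Fin (d + 1)), W (z + P • e i) = W z) →
    InAk L m η α₀ (fun _ => (Set.univ : Set (LSite (d + 1)))) U₀ →
    InAk L m η α₀ (fun _ => (Set.univ : Set (LSite (d + 1)))) (mulCfg W U₀) →
    IsLandau138W L m η (Set.univ : Set (LSite (d + 1))) (torusLam (d := d + 1) m) U₀ W →
    ∀ A' : LSite (d + 1) → Fin (d + 1) → 𝔸, (∀ y τ, IsSelfAdjoint (A' y τ)) →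
    (∀ (z : LSite (d + 1)) (i : Fin (d + 1)), A' (z + P • e i) = A' z) →
    (∀ (y : LSite (d + 1)) (τ : Fin (d + 1)), W y τ = cfgExp η A' y τ) →
    (∀ (y : LSite (d + 1)) (τ : Fin (d + 1)), ‖A' y τ‖ ≤ α₂ * ((L : ℝ) ^ m * η)⁻¹) →
    (∀ (y : LSite (d + 1)) (τ : Fin (d + 1)), (L : ℝ) ^ m * η * ‖A' y τ‖
        ≤ B₀ * (bondNorm L m η (-(3 : ℝ)) (fun _ => (Set.univ : Set (LSite (d + 1)))) (fun x μ => Jcur η U₀ A' μ x)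
          + wsup 1 (fun p : {p : ℕ × (LSite (d + 1) × Fin (d + 1)) // p.1 ≤ m ∧ p.2 ∈ torusLamb (d := d + 1) m p.1} =>
              linCovIter L U₀ (iEta η A') p.1.1 p.1.2.1 p.1.2.2))) ∧
    (∀ (μ κ : Fin (d + 1)) (y : LSite (d + 1)), ((L : ℝ) ^ m * η) ^ 2 * ‖covDerivFwd η U₀ μ (fun z => A' z κ) y‖
        ≤ B₀ * (bondNorm L m η (-(3 : ℝ)) (fun _ => (Set.univ : Set (LSite (d + 1)))) (fun x μ => Jcur η U₀ A' μ x)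
          + wsup 1 (fun p : {p : ℕ × (LSite (d + 1) × Fin (d + 1)) // p.1 ≤ m ∧ p.2 ∈ torusLamb (d := d + 1) m p.1} =>
              linCovIter L U₀ (iEta η A') p.1.1 p.1.2.1 p.1.2.2))) ∧
    (∀ (y : LSite (d + 1)) (κ : Fin (d + 1)), ((L : ℝ) ^ m * η) ^ 3 * ‖covLap η U₀ (fun z => A' z κ) y‖
        ≤ B₀ * (bondNorm L m η (-(3 : ℝ)) (fun _ => (Set.univ : Set (LSite (d + 1)))) (fun x μ => Jcur η U₀ A' μ x)
          + wsup 1 (fun p : {p : ℕ × (LSite (d + 1) × Fin (d + 1)) // p.1 ≤ m ∧ p.2 ∈ torusLamb (d := d + 1) m p.1} =>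
              linCovIter L U₀ (iEta η A') p.1.1 p.1.2.1 p.1.2.2)))

/-- The three-line predicate is monotone in the constant `B₀` (larger constant, weaker claim). [cite: Balaban1985RegularSpaces, (1.59) p.86, bookkeeping] -/
theorem b9P3ThreeAt_mono {L : ℕ} {B₀ B₀' cB : ℝ} (hB : B₀ ≤ B₀') {η : ℝ} (hη : 0 ≤ η) {m : ℕ} {α₀ : ℝ} {P : ℤ}
    {U₀ : LSite (d + 1) → Fin (d + 1) → 𝔸ˣ} (h : B9P3ThreeAt L B₀ cB η m α₀ P U₀) : B9P3ThreeAt L B₀' cB η m α₀ P U₀ := by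
  intro α₂ hα₂ hα₂c W hWu hWper h33 h34 hLan A' hsa hAper hexp hbd
  obtain ⟨l1, l2, l4⟩ := h α₂ hα₂ hα₂c W hWu hWper h33 h34 hLan A' hsa hAper hexp hbd
  have hN0 : 0 ≤ bondNorm L m η (-(3 : ℝ)) (fun _ => (Set.univ : Set (LSite (d + 1)))) (fun x μ => Jcur η U₀ A' μ x)
      + wsup 1 (fun p : {p : ℕ × (LSite (d + 1) × Fin (d + 1)) // p.1 ≤ m ∧ p.2 ∈ torusLamb (d := d + 1) m p.1} =>
          linCovIter L U₀ (iEta η A') p.1.1 p.1.2.1 p.1.2.2) :=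
    add_nonneg (msup_nonneg L m hη _ _ _) (wsup_nonneg zero_le_one _)
  have hmono := mul_le_mul_of_nonneg_right hB hN0
  exact ⟨fun y τ => (l1 y τ).trans hmono, fun μ κ y => (l2 μ κ y).trans hmono, fun y κ => (l4 y κ).trans hmono⟩

end Three

/-! ## §2 ★★ The five-line (B)-line from its three genuine members (`β = 0`) -/

section Reduction

variable {d : ℕ} {𝔸 : Type} [CStarAlgebra 𝔸] [Nontrivial 𝔸]

/-- ★★ **THE (B)-LINE `B9P3PerAt` FROM ITS THREE GENUINE MEMBERS, HÖLDER EXPONENT `β = 0`.**  For `d + 1 ≥ 2`, `L ≥ 1`, `η > 0`, `B₀ ≥ 1` and a unitary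
background `U₀`: `B9P3ThreeAt L B₀ c_B η m α₀ P U₀ → B9P3PerAt L B₀ (2B₀) c_B 0 len η m α₀ P U₀` for every length function `len`.  PROOF (bookkeeping):
every bond∕site∕pair «belongs to Ω_j = T_η» (`sideTouches_univ`), and `(Lʲη)ᵖ ≤ (Lᵐη)ᵖ` for `j ≤ m`, so each weighted member is below its top-weight
pointwise reading — lines 1, 2, 4; line 3 is `|J|₍₋₃₎ ≤ B₀(|J|₍₋₃₎ + |B₁|)` (`J = D^{η*}D^ηA′` definitionally, `B₀ ≥ 1`, `|B₁| ≥ 0`); line 5 at `β = 0`: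
`(Lʲη)²‖R(U₀(Γ_{x,x′}))(DA′)(x′) − (DA′)(x)‖ ≤ (Lᵐη)²(‖DA′(x′)‖ + ‖DA′(x)‖) ≤ 2B₀(|J|₍₋₃₎ + |B₁|)` (`norm_trans`: the transport is isometric).
[cite: Balaban1985RegularSpaces, (1.59) p.86, p.86 (norms after (1.55)), Prop. 3 p.87, p.77; Balaban1985BackgroundPropagators, (3.40) p.397, (3.47) p.398, Thm 3.3 p.399] -/
theorem b9P3PerAt_of_three (hd2 : 2 ≤ d + 1) {L : ℕ} (hL : 1 ≤ L) {η : ℝ} (hη : 0 < η) {B₀ cB : ℝ} (hB₀ : 1 ≤ B₀)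
    {m : ℕ} {α₀ : ℝ} {P : ℤ} {U₀ : LSite (d + 1) → Fin (d + 1) → 𝔸ˣ} (hU₀ : ∀ x κ, U₀ x κ ∈ unitaryUnits 𝔸)
    (h : B9P3ThreeAt L B₀ cB η m α₀ P U₀) (len : LSite (d + 1) → ℝ) :
    B9P3PerAt (𝔸 := 𝔸) L B₀ (2 * B₀) cB 0 len η m α₀ P U₀ := by
  intro α₂ hα₂ hα₂c W hWu hWper h33 h34 hLan A' hsa hAper hWA _
  -- the data of the three-line predicate
  have hexp : ∀ (y : LSite (d + 1)) (τ : Fin (d + 1)), W y τ = cfgExp η A' y τ :=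
    fun y τ => (hWA 0 (Nat.zero_le _) y τ (sideTouches_univ hd2 y τ)).1
  have hbd : ∀ (y : LSite (d + 1)) (τ : Fin (d + 1)), ‖A' y τ‖ ≤ α₂ * ((L : ℝ) ^ m * η)⁻¹ :=
    fun y τ => (hWA m le_rfl y τ (sideTouches_univ hd2 y τ)).2
  obtain ⟨l1, l2, l4⟩ := h α₂ hα₂ hα₂c W hWu hWper h33 h34 hLan A' hsa hAper hexp hbd
  -- name the right side
  obtain ⟨N, hN⟩ : ∃ N : ℝ, N = bondNorm L m η (-(3 : ℝ)) (fun _ => (Set.univ : Set (LSite (d + 1)))) (fun x μ => Jcur η U₀ A' μ x)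
      + wsup 1 (fun p : {p : ℕ × (LSite (d + 1) × Fin (d + 1)) // p.1 ≤ m ∧ p.2 ∈ torusLamb (d := d + 1) m p.1} =>
          linCovIter L U₀ (iEta η A') p.1.1 p.1.2.1 p.1.2.2) := ⟨_, rfl⟩
  have hJ0 : 0 ≤ bondNorm L m η (-(3 : ℝ)) (fun _ => (Set.univ : Set (LSite (d + 1)))) (fun x μ => Jcur η U₀ A' μ x) :=
    msup_nonneg L m hη.le _ _ _
  have hW0 : 0 ≤ wsup 1 (fun p : {p : ℕ × (LSite (d + 1) × Fin (d + 1)) // p.1 ≤ m ∧ p.2 ∈ torusLamb (d := d + 1) m p.1} =>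
      linCovIter L U₀ (iEta η A') p.1.1 p.1.2.1 p.1.2.2) := wsup_nonneg zero_le_one _
  have hN0 : 0 ≤ N := by rw [hN]; exact add_nonneg hJ0 hW0
  rw [← hN] at l1 l2 l4 ⊢
  have hB₀0 : 0 ≤ B₀ := zero_le_one.trans hB₀
  have hBN : 0 ≤ B₀ * N := mul_nonneg hB₀0 hN0
  have hU₀1 : ∀ x κ, U₀ x κ ∈ U1 𝔸 := fun x κ => unitaryUnits_le_U1 (hU₀ x κ)
  have hLr : (1 : ℝ) ≤ L := by exact_mod_cast hL
  have hsc : ∀ {j : ℕ}, j ≤ m → (L : ℝ) ^ j * η ≤ (L : ℝ) ^ m * η :=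
    fun hj => mul_le_mul_of_nonneg_right (pow_le_pow_right₀ hLr hj) hη.le
  have hw1 : ∀ j, weight L η (-(1 : ℝ)) j = (L : ℝ) ^ j * η := fun j => by
    have e1 : (-(1 : ℝ)) = -((1 : ℕ) : ℝ) := by norm_num
    rw [e1, weight_neg_natCast, pow_one]
  have hw2 : ∀ j, weight L η (-(2 : ℝ)) j = ((L : ℝ) ^ j * η) ^ 2 := fun j => by
    have e2 : (-(2 : ℝ)) = -((2 : ℕ) : ℝ) := by norm_num
    rw [e2, weight_neg_natCast]
  have hw3 : ∀ j, weight L η (-(3 : ℝ)) j = ((L : ℝ) ^ j * η) ^ 3 := fun j => by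
    have e3 : (-(3 : ℝ)) = -((3 : ℕ) : ℝ) := by norm_num
    rw [e3, weight_neg_natCast]
  have hw20 : ∀ j, weight L η (-(2 + 0 : ℝ)) j = ((L : ℝ) ^ j * η) ^ 2 := fun j => by
    rw [add_zero]; exact hw2 j
  refine ⟨?_, ?_, ?_, ?_, ?_⟩
  · -- line 1: the sup member
    refine msup_le hBN fun j hj b _ => ?_
    rw [hw1 j]
    calc (L : ℝ) ^ j * η * ‖A' b.1 b.2‖ ≤ (L : ℝ) ^ m * η * ‖A' b.1 b.2‖ :=
          mul_le_mul_of_nonneg_right (hsc hj) (norm_nonneg _)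
      _ ≤ B₀ * N := l1 b.1 b.2
  · -- line 2: the gradient member
    refine msup_le hBN fun j hj t _ => ?_
    rw [hw2 j]
    calc ((L : ℝ) ^ j * η) ^ 2 * ‖covDerivFwd η U₀ t.1 (fun z => A' z t.2.1) t.2.2‖
        ≤ ((L : ℝ) ^ m * η) ^ 2 * ‖covDerivFwd η U₀ t.1 (fun z => A' z t.2.1) t.2.2‖ :=
          mul_le_mul_of_nonneg_right (pow_le_pow_left₀ (scale_pos hL hη j).le (hsc hj) 2) (norm_nonneg _)
      _ ≤ B₀ * N := l2 t.1 t.2.1 t.2.2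
  · -- line 3: `|D^{η*}D^ηA′|₍₋₃₎` IS `|J|₍₋₃₎`
    show bondNorm L m η (-(3 : ℝ)) (fun _ => (Set.univ : Set (LSite (d + 1)))) (fun x μ => Jcur η U₀ A' μ x) ≤ B₀ * N
    have h1 : bondNorm L m η (-(3 : ℝ)) (fun _ => (Set.univ : Set (LSite (d + 1)))) (fun x μ => Jcur η U₀ A' μ x) ≤ N := by
      rw [hN]; exact le_add_of_nonneg_right hW0
    calc bondNorm L m η (-(3 : ℝ)) (fun _ => (Set.univ : Set (LSite (d + 1)))) (fun x μ => Jcur η U₀ A' μ x)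
        ≤ N := h1
      _ = 1 * N := (one_mul N).symm
      _ ≤ B₀ * N := mul_le_mul_of_nonneg_right hB₀ hN0
  · -- line 4: the Laplacian member
    show msup L m η (-(3 : ℝ)) _ _ ≤ B₀ * N
    refine msup_le hBN fun j hj b _ => ?_
    rw [hw3 j]
    calc ((L : ℝ) ^ j * η) ^ 3 * ‖covLap η U₀ (fun z => A' z b.2) b.1‖
        ≤ ((L : ℝ) ^ m * η) ^ 3 * ‖covLap η U₀ (fun z => A' z b.2) b.1‖ :=
          mul_le_mul_of_nonneg_right (pow_le_pow_left₀ (scale_pos hL hη j).le (hsc hj) 3) (norm_nonneg _)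
      _ ≤ B₀ * N := l4 b.1 b.2
  · -- line 5 at `β = 0`: the plain oscillation of the gradient from line 2 at both points
    have h2BN : 0 ≤ 2 * B₀ * N := by positivity
    refine msup_le h2BN fun j hj q _ => ?_
    rw [hw20 j]
    unfold hquot
    rw [Real.rpow_zero, div_one, norm_norm]
    calc ((L : ℝ) ^ j * η) ^ 2 *
          ‖B9Eq340HolderZd.trans U₀ q.2.2.1 q.2.2.2 (covDerivFwd η U₀ q.1 (fun z => A' z q.2.1) q.2.2.2)
            - covDerivFwd η U₀ q.1 (fun z => A' z q.2.1) q.2.2.1‖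
        ≤ ((L : ℝ) ^ m * η) ^ 2 *
          (‖covDerivFwd η U₀ q.1 (fun z => A' z q.2.1) q.2.2.2‖ + ‖covDerivFwd η U₀ q.1 (fun z => A' z q.2.1) q.2.2.1‖) := by
          refine mul_le_mul (pow_le_pow_left₀ (scale_pos hL hη j).le (hsc hj) 2) ((norm_sub_le _ _).trans ?_) (norm_nonneg _)
            (by positivity)
          rw [norm_trans hU₀1]
      _ = ((L : ℝ) ^ m * η) ^ 2 * ‖covDerivFwd η U₀ q.1 (fun z => A' z q.2.1) q.2.2.2‖
          + ((L : ℝ) ^ m * η) ^ 2 * ‖covDerivFwd η U₀ q.1 (fun z => A' z q.2.1) q.2.2.1‖ := mul_add _ _ _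
      _ ≤ B₀ * N + B₀ * N := add_le_add (l2 q.1 q.2.1 q.2.2.2) (l2 q.1 q.2.1 q.2.2.1)
      _ = 2 * B₀ * N := by ring

/-! ## §3 ★ The route-K ∕ N05 socket at the all-torus member feeds the (B)-line -/

omit [Nontrivial 𝔸] in
/-- ★ **THE ROUTE-K SOCKET `SockB9P3` AT `({T_η}, torusLam, torusLamb)` GIVES THE (B)-LINE AT EVERY UNITARY BACKGROUND** with `0 < α₀ ≤ c_B`: the socket
quantifies over all unitary `U₀, W` and all Hermitian exponents; the (B)-line asks the same at one `U₀` for PERIODIC `W, A′` only, so its periodicity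
clauses are simply not used.  Any supplier of the socket at the all-torus member feeds the sub-row by name.
[cite: Balaban1985RegularSpaces, (1.59) p.86, p.77; Balaban1985BackgroundPropagators, Thm 3.3 p.399] -/
theorem b9P3PerAt_of_sockB9P3 {L : ℕ} {B₀ B₀β cB β' : ℝ} {len : LSite (d + 1) → ℝ} {η : ℝ} {m : ℕ}
    (S : SockB9P3 (𝔸 := 𝔸) L B₀ B₀β cB β' len η m (fun _ => (Set.univ : Set (LSite (d + 1))))
      (fun m' => torusLam (d := d + 1) m') (fun m' => torusLamb (d := d + 1) m'))
    {α₀ : ℝ} (hα₀ : 0 < α₀) (hα₀c : α₀ ≤ cB) (P : ℤ) {U₀ : LSite (d + 1) → Fin (d + 1) → 𝔸ˣ}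
    (hU₀ : ∀ x κ, U₀ x κ ∈ unitaryUnits 𝔸) :
    B9P3PerAt (𝔸 := 𝔸) L B₀ B₀β cB β' len η m α₀ P U₀ := by
  intro α₂ hα₂ hα₂c W hWu _ h33 h34 hLan A' hsa _ hWA hA0
  exact S α₀ α₂ hα₀ hα₀c hα₂ hα₂c U₀ W hU₀ hWu h33 h34 hLan A' hsa hWA hA0

end Reduction

/-! ## §4 ★★★★★★★ The consumer's binder with the (B)-lines reduced to their three genuine members -/

section Binder

variable {ℓ : ℕ} {hL : Odd (ℓ + 1) ∧ 1 < ℓ + 1} {b₀ b₁ : ℝ}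
variable {hd₃ : 1 ≤ 2 + 1}
variable [instF : ∀ i : KIdx 2 ℓ hd₃ hL b₀ b₁, Fintype (geo9K i).Site] [∀ i : KIdx 2 ℓ hd₃ hL b₀ b₁, DecidableEq (geo9K i).Site]

/-- ★★★★★★★ **THE `hThm2S`-SHAPE BINDER OF THE 19200 CONSUMER, WITH THE (B)-LINES REDUCED** — file A15's `hThm2_of_core_sharp` VERBATIM except that the
per-member (B)-line hypothesis `B9P3PerAt (ℓ+1) B₀ B₀β c_B9 β_H len η m′ α₀ P₀ U₀` is REPLACED by the three-line predicate `B9P3ThreeAt (ℓ+1) B₀ c_B9 η m′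
α₀ P₀ U₀` (`1 ≤ B₀`; the binder's own `β₀ = 0` makes `β_H := 0`, `B₀β := 2B₀`, `len := 1` admissible, §2).  So the consumer's `hThm2S` is served modulo
EXACTLY: `4 ≤ ℓ` (L ≥ 5 odd), the volume floor `k₀ ≤ F.m + n`, the [4] Thm-3.7∕3.9 core cube data `KnitCubeCore` per member and background, and the THREE
[4] (3.47)_{γ=−3}-lines per member and background.  Antecedents displayed, inhabited by nothing here; no estimate of [B8]∕[4] proved; `stub_PV3A` NOT
discharged; the Yang–Mills mass gap is NOT proved.
[cite: Balaban1985RegularSpaces, Thm 2 p.83, (1.59) p.86, Prop. 3 p.87; Balaban1985BackgroundPropagators, Thm 3.3 p.399, (3.47) p.398, Thm 3.7 p.409, Thm 3.9 p.413; Balaban1984PropagatorsII, (2.1)–(2.4) p.224, Lemma 2.1 p.234] -/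
theorem hThm2_of_core_three (hℓ : 4 ≤ ℓ) (hb₀ : 0 < b₀) (hb₁ : b₀ ≤ b₁)
    {B₀ cB9 : ℝ} (hB₀ : 1 ≤ B₀) (hB : 2 ≤ 5 * ((2 + 1 : ℕ) : ℝ) * ((ℓ + 1 : ℕ) : ℝ) * B₀) (hcB9 : 0 < cB9)
    {ι : Type} [Fintype ι] [DecidableEq ι] (b : Module.Basis ι ℝ (Matrix (Fin 2) (Fin 2) ℂ)) {M₂ : ℝ} (hM₂ : 0 ≤ M₂)
    (hrepr : ∀ (v : Matrix (Fin 2) (Fin 2) ℂ) (j : ι), |b.repr v j| ≤ M₂ * ‖v‖)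
    {BG₀ δG₀ NG NG' AE Ac δc BC δC Nn κD : ℝ} (hBG₀ : 0 ≤ BG₀) (hδG₀ : 0 < δG₀) (hNG : 0 ≤ NG) (hNG' : 0 ≤ NG')
    (hAE : 0 ≤ AE) (hAc : 0 ≤ Ac) (hδc : 0 < δc) (hBC : 0 ≤ BC) (hδC : 0 < δC) (hNn : 0 ≤ Nn) (hκD : 0 ≤ κD) (Rr : ℝ) (Hp : Prop) :
    letI : CStarAlgebra (Matrix (Fin 2) (Fin 2) ℂ) := {}
    ∃ θs ℓs Ds cL A δG δ₀ : ℝ, 0 < θs ∧ 0 < ℓs ∧ 0 < cL ∧ Ac ≤ A ∧ 0 < δG ∧ δG ≤ δc ∧ 0 < δ₀ ∧ δ₀ ≤ δC ∧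
      ∀ θG ℓ₀ ℓ₁ Dsep : ℝ, 0 ≤ θG → θG ≤ θs → 0 ≤ ℓ₀ → ℓ₀ ≤ ℓs → 0 ≤ ℓ₁ → ℓ₁ ≤ ℓs → Ds ≤ Dsep →
        ∃ p : KnitCubeParams,
          (p.BG₀ = BG₀ ∧ p.δG₀ = δG₀ ∧ p.NG = NG ∧ p.NG' = NG' ∧ p.AE = AE ∧ p.θG = θG ∧ p.A = A ∧ p.δG = δG ∧
            p.B₀ = BC ∧ p.δ₀ = δ₀ ∧ p.bb = 1 ∧ p.aD = 1 ∧ p.Nn = Nn ∧ p.κD = κD ∧ p.Dsep = Dsep ∧ p.ℓ₀ = ℓ₀ ∧ p.ℓ₁ = ℓ₁) ∧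
        ∃ (k₀ : ℕ) (mem : ℤ → ℕ → KIdx 2 ℓ hd₃ hL b₀ b₁) (ιBm : ∀ P n, BlkY (mem P n) → IBondY (mem P n)) (B₁ B₂ c₁ : ℝ),
          0 < B₁ ∧ 0 < B₂ ∧ 0 < c₁ ∧
          (∀ (m K n : ℕ), 1 ≤ n → n + k₀ ≤ m + K →
            (mem (((PV 2 ℓ m K hd₃ hL).sitesPerDir 0 : ℕ) : ℤ) n).m = m + K ∧ (mem (((PV 2 ℓ m K hd₃ hL).sitesPerDir 0 : ℕ) : ℤ) n).K = 0 ∧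
            (mem (((PV 2 ℓ m K hd₃ hL).sitesPerDir 0 : ℕ) : ℤ) n).k = n + 1 ∧
            (mem (((PV 2 ℓ m K hd₃ hL).sitesPerDir 0 : ℕ) : ℤ) n).cf = (((ℓ + 1 : ℕ) : ℝ)) ^ (mem (((PV 2 ℓ m K hd₃ hL).sitesPerDir 0 : ℕ) : ℤ) n).k ∧
            (∀ z : SiteY (mem (((PV 2 ℓ m K hd₃ hL).sitesPerDir 0 : ℕ) : ℤ) n), levY (mem (((PV 2 ℓ m K hd₃ hL).sitesPerDir 0 : ℕ) : ℤ) n) z = n) ∧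
            ∀ t, β (mem (((PV 2 ℓ m K hd₃ hL).sitesPerDir 0 : ℕ) : ℤ) n).hN (mem (((PV 2 ℓ m K hd₃ hL).sitesPerDir 0 : ℕ) : ℤ) n).D
              (mem (((PV 2 ℓ m K hd₃ hL).sitesPerDir 0 : ℕ) : ℤ) n).hk (ιBm (((PV 2 ℓ m K hd₃ hL).sitesPerDir 0 : ℕ) : ℤ) n t) = t) ∧
          ∀ F : T3Family, F.L = ℓ + 1 → ∀ (n K : ℕ), n < K → k₀ ≤ F.m + n →
            (∀ j, 1 ≤ j → j ≤ K - n → ∀ ⦃α₀ : ℝ⦄, 0 < α₀ → α₀ ≤ cL → ∀ U₀ : LSite (2 + 1) → Fin (2 + 1) → (Matrix (Fin 2) (Fin 2) ℂ)ˣ,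
                (∀ x κ, U₀ x κ ∈ specialUnitaryUnits (Fin 2)) →
                (∀ (x : LSite (2 + 1)) (μ : Fin (2 + 1)), U₀ (x + (((PV 2 ℓ F.m K hd₃ hL).sitesPerDir 0 : ℕ) : ℤ) • e μ) = U₀ x) →
                InAk (ℓ + 1) j (eta F n K) α₀ (fun _ => (Set.univ : Set (LSite (2 + 1)))) U₀ →
                Nonempty (KnitCubeCore (mem (((PV 2 ℓ F.m K hd₃ hL).sitesPerDir 0 : ℕ) : ℤ) j)
                  (bgY (mem (((PV 2 ℓ F.m K hd₃ hL).sitesPerDir 0 : ℕ) : ℤ) j) U₀) b (ιBm (((PV 2 ℓ F.m K hd₃ hL).sitesPerDir 0 : ℕ) : ℤ) j) Rr Hp p)) →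
            (∀ m', m' ≤ K - n → ∀ ⦃α₀ : ℝ⦄, 0 < α₀ → α₀ ≤ cL → ∀ U₀ : LSite (2 + 1) → Fin (2 + 1) → (Matrix (Fin 2) (Fin 2) ℂ)ˣ,
                (∀ x κ, U₀ x κ ∈ specialUnitaryUnits (Fin 2)) →
                (∀ (x : LSite (2 + 1)) (μ : Fin (2 + 1)), U₀ (x + (((PV 2 ℓ F.m K hd₃ hL).sitesPerDir 0 : ℕ) : ℤ) • e μ) = U₀ x) →
                InAk (ℓ + 1) m' (eta F n K) α₀ (fun _ => (Set.univ : Set (LSite (2 + 1)))) U₀ →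
                B9P3ThreeAt (𝔸 := Matrix (Fin 2) (Fin 2) ℂ) (ℓ + 1) B₀ cB9 (eta F n K) m' α₀ (((PV 2 ℓ F.m K hd₃ hL).sitesPerDir 0 : ℕ) : ℤ) U₀) →
            ∃ (β₀ B₂' : ℝ) (len' : LSite (F.P K).d → ℝ),
              Thm2SetupSUAt (F.P K) 2 (K - n) (eta F n K) β₀ B₁ B₂' c₁ len' (fun _ => True) := by
  letI : CStarAlgebra (Matrix (Fin 2) (Fin 2) ℂ) := {}
  obtain ⟨θs, ℓs, Ds, cL, A, δG, δ₀, hθs, hℓs, hcL, hA, hδG, hδGc, hδ₀, hδ₀C, H⟩ :=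
    hThm2_of_core_sharp (hd₃ := hd₃) (hL := hL) (b₀ := b₀) (b₁ := b₁) (len := fun _ => (1 : ℝ)) (B₀β := 2 * B₀)
      (βH := 0) hℓ hb₀ hb₁ (lt_of_lt_of_le one_pos hB₀) hB hcB9 b hM₂ hrepr hBG₀ hδG₀ hNG hNG' hAE hAc hδc hBC hδC hNn hκD Rr Hp
  refine ⟨θs, ℓs, Ds, cL, A, δG, δ₀, hθs, hℓs, hcL, hA, hδG, hδGc, hδ₀, hδ₀C, fun θG ℓ₀ ℓ₁ Dsep h1 h2 h3 h4 h5 h6 h7 => ?_⟩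
  obtain ⟨p, hspec, k₀, mem, ιBm, B₁, B₂, c₁, hB₁, hB₂, hc₁, hcat, hend⟩ := H θG ℓ₀ ℓ₁ Dsep h1 h2 h3 h4 h5 h6 h7
  refine ⟨p, hspec, k₀, mem, ιBm, B₁, B₂, c₁, hB₁, hB₂, hc₁, hcat, fun F hF n K hnK hm han hb3 => ?_⟩
  exact hend F hF n K hnK hm han fun m' hm' α₀ hα hαc U₀ hG hper hAk =>
    b9P3PerAt_of_three (d := 2) (by norm_num) (by omega) (eta_pos F n K) hB₀
      (fun x κ => specialUnitaryUnits_le_unitaryUnits (hG x κ)) (hb3 m' hm' hα hαc U₀ hG hper hAk) _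

end Binder

end Literature.MathematicalPhysics.QuantumFieldTheory.Balaban1983to89.B8Thm2TorusB9LineReduced

end
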